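import Literature.Analysis.FluidPDE.SourcedScalarBudget

/-!
# Condensate theorem, stub C: power from dissipation

For a global weak solution `θ` of the sourced passive scalar equation
`∂ₜθ + u·∇θ = κΔθ + h` on `T² × [0, ∞)` (steady smooth source `h`, `L²` datum `θ₀`) over a
drift with `∫₀ᵀ ‖∇u‖_{L²} < ∞` for every `T`, the budget `(H1)` of `SourcedScalarBudget`,
`∫₀ᵗ κ‖∇θ‖² ≤ ½∫θ₀² + ∫₀ᵗ P` (with the trace `P = ∫ θ h` a.e.), integrated once more over
`t ∈ (0, T)` and combined with the monotonicity of the cumulative dissipation `t ↦ ∫₀ᵗ κ‖∇θ‖²`,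
gives the lower bound of the double Cesàro integral of the power input by the dissipation:
`(T/2) ∫₀^{T/2} κ‖∇θ‖² ≤ T·½∫θ₀² + ∫₀ᵀ ∫₀ᵗ ∫ θ(τ) h dτ dt`.
-/

namespace Summit.AnomalousDissipation.AnomalousDissipation.Theorems.TwohalfdNeg.Condensate

open MeasureTheory Filter Topology
open scoped ENNReal NNReal InnerProductSpace
open Literature.Analysis.FunctionSpaces Literature.Analysis.FluidPDE

set_option linter.dupNamespace false

/-- **Half-time lower bound of a double time integral.** If `D ≥ 0` is integrable on `(0, T]`,
then `(T/2) ∫₀^{T/2} D ≤ ∫₀ᵀ (∫₀ᵗ D) dt`: the primitive `t ↦ ∫₀ᵗ D` is nonnegative and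
monotone, so `∫₀ᵀ ∫₀ᵗ D ≥ ∫_{T/2}^{T} ∫₀ᵗ D ≥ ∫_{T/2}^{T} ∫₀^{T/2} D = (T/2) ∫₀^{T/2} D`.
[folklore] -/
theorem half_mul_intervalIntegral_le_intervalIntegral_primitive {D : ℝ → ℝ} {T : ℝ}
    (hT : 0 < T) (hD : ∀ t, 0 ≤ D t) (hDi : IntegrableOn D (Set.Ioc 0 T) volume) :
    T / 2 * ∫ s in (0 : ℝ)..(T / 2), D s ≤ ∫ t in (0 : ℝ)..T, ∫ s in (0 : ℝ)..t, D s := by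
  have hT2 : 0 ≤ T / 2 := by positivity
  have hT2' : T / 2 ≤ T := by linarith
  -- interval integrability of `D` on `[0, t]` for `0 ≤ t ≤ T`
  have hDt : ∀ t, 0 ≤ t → t ≤ T → IntervalIntegrable D volume 0 t := fun t ht htT =>
    (intervalIntegrable_iff_integrableOn_Ioc_of_le ht).2
      (hDi.mono_set (Set.Ioc_subset_Ioc_right htT))
  -- the primitive is continuous on `[0, T]`, hence interval integrable on subintervals
  have hFc : ContinuousOn (fun t => ∫ s in (0 : ℝ)..t, D s) (Set.uIcc 0 T) :=
    intervalIntegral.continuousOn_primitive_interval' (hDt T hT.le le_rfl) Set.left_mem_uIcc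
  have hFi : IntervalIntegrable (fun t => ∫ s in (0 : ℝ)..t, D s) volume 0 T :=
    hFc.intervalIntegrable
  have hFi' : IntervalIntegrable (fun t => ∫ s in (0 : ℝ)..t, D s) volume (T / 2) T := by
    refine (hFc.mono ?_).intervalIntegrable
    rw [Set.uIcc_of_le hT.le, Set.uIcc_of_le hT2']
    exact Set.Icc_subset_Icc_left hT2
  -- nonnegativity and monotonicity of the primitive
  have hF0 : ∀ t, 0 ≤ t → 0 ≤ ∫ s in (0 : ℝ)..t, D s := fun t ht =>
    intervalIntegral.integral_nonneg ht fun s _ => hD s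
  have hFmono : ∀ t, T / 2 ≤ t → t ≤ T →
      ∫ s in (0 : ℝ)..(T / 2), D s ≤ ∫ s in (0 : ℝ)..t, D s := fun t ht htT =>
    intervalIntegral.integral_mono_interval le_rfl hT2 ht (Eventually.of_forall fun s => hD s)
      (hDt t (hT2.trans ht) htT)
  calc T / 2 * ∫ s in (0 : ℝ)..(T / 2), D s
      = ∫ _ in (T / 2 : ℝ)..T, ∫ s in (0 : ℝ)..(T / 2), D s := by
        rw [intervalIntegral.integral_const, smul_eq_mul]
        ring
    _ ≤ ∫ t in (T / 2 : ℝ)..T, ∫ s in (0 : ℝ)..t, D s :=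
        intervalIntegral.integral_mono_on hT2' intervalIntegrable_const hFi'
          fun t ht => hFmono t ht.1 ht.2
    _ ≤ ∫ t in (0 : ℝ)..T, ∫ s in (0 : ℝ)..t, D s :=
        intervalIntegral.integral_mono_interval hT2 hT2' le_rfl
          ((ae_restrict_iff' measurableSet_Ioc).2 (Eventually.of_forall fun t ht => hF0 t ht.1.le))
          hFi

/-- **Stub C — power from dissipation.** `(H1)` of `SourcedScalarBudget` integrated once more in
time and the monotonicity of `t ↦ ∫₀ᵗ κ‖∇θ‖²`:
`(T/2) ∫₀^{T/2} κ‖∇θ‖² ≤ T·½∫θ₀² + ∫₀ᵀ∫₀ᵗ ∫θ(τ)h dτ dt`. [folklore] -/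
theorem stub_condensatePowerFromDissipation :
    ∀ (κ T : ℝ) (u : ℝ → UnitAddTorus (Fin 2) → EuclideanSpace ℝ (Fin 2))
      (h θ₀ : UnitAddTorus (Fin 2) → ℝ) (θ : ℝ → UnitAddTorus (Fin 2) → ℝ),
      0 < κ → 0 < T → Torus.IsWeakScalarTransportForced κ u (fun _ => h) θ₀ θ →
      MemLp θ₀ 2 volume → Torus.IsSmooth h →
      (∀ T', 0 < T' → ∫⁻ t in Set.Ioo 0 T', Torus.eGradNormSq (u t) ^ (1 / 2 : ℝ) < ⊤) →
      T / 2 * ∫ t in (0 : ℝ)..(T / 2), κ * (Torus.eScalarGradNormSq (θ t)).toReal ≤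
        T * (1 / 2 * ∫ x, θ₀ x ^ 2) +
          ∫ t in (0 : ℝ)..T, ∫ τ in (0 : ℝ)..t, ∫ x, θ τ x * h x := by
  intro κ T u h θ₀ θ hκ hT hθ hθ₀ hh hG
  -- the dissipation rate is nonnegative and integrable on `(0, T]`
  have hD0 : ∀ t, 0 ≤ κ * (Torus.eScalarGradNormSq (θ t)).toReal := fun t =>
    mul_nonneg hκ.le ENNReal.toReal_nonneg
  have hDi : IntegrableOn (fun t => κ * (Torus.eScalarGradNormSq (θ t)).toReal) (Set.Ioc 0 T)
      volume :=
    (Torus.integrableOn_dissipationRate hκ hθ hθ₀ hh hG hT).1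
  -- the trace of the power input is `∫ θ(t) h` for a.e. `t > 0`
  have hae := (ae_restrict_iff' (μ := (volume : Measure ℝ)) measurableSet_Ioi).1
    (Torus.ae_integral_mul_eq_trace hθ hh)
  -- `(H1)` with the trace replaced by the power input, for every `t > 0`
  have hH1 : ∀ t, 0 < t → ∫ s in (0 : ℝ)..t, κ * (Torus.eScalarGradNormSq (θ s)).toReal ≤
      1 / 2 * (∫ y, θ₀ y ^ 2) + ∫ s in (0 : ℝ)..t, ∫ x, θ s x * h x := by
    intro t ht
    refine (Torus.intervalIntegral_dissipationRate_le hκ hθ hθ₀ hh hG ht).trans (le_of_eq ?_)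
    congr 1
    refine intervalIntegral.integral_congr_ae ?_
    filter_upwards [hae] with s hs hmem
    rw [Set.uIoc_of_le ht.le] at hmem
    exact (hs hmem.1).symm
  -- the power input is integrable on `(0, T)`; its primitive is continuous on `[0, T]`
  have hpi : IntegrableOn (fun s => ∫ x, θ s x * h x) (Set.Ioo 0 T) volume :=
    ((hθ T hT).integrable_mul_continuous hh.continuous).integral_prod_left
  have hpI : IntervalIntegrable (fun s => ∫ x, θ s x * h x) volume 0 T :=
    (intervalIntegrable_iff_integrableOn_Ioo_of_le hT.le).2 hpi
  have hGi : IntervalIntegrable (fun t => ∫ s in (0 : ℝ)..t, ∫ x, θ s x * h x) volume 0 T :=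
    (intervalIntegral.continuousOn_primitive_interval' hpI Set.left_mem_uIcc).intervalIntegrable
  -- the primitive of the dissipation rate is continuous on `[0, T]`
  have hFi : IntervalIntegrable
      (fun t => ∫ s in (0 : ℝ)..t, κ * (Torus.eScalarGradNormSq (θ s)).toReal) volume 0 T :=
    (intervalIntegral.continuousOn_primitive_interval'
      ((intervalIntegrable_iff_integrableOn_Ioc_of_le hT.le).2 hDi) Set.left_mem_uIcc).intervalIntegrable
  -- integrate `(H1)` over `t ∈ (0, T)`
  have hint : ∫ t in (0 : ℝ)..T, ∫ s in (0 : ℝ)..t, κ * (Torus.eScalarGradNormSq (θ s)).toReal ≤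
      ∫ t in (0 : ℝ)..T, (1 / 2 * (∫ y, θ₀ y ^ 2) + ∫ s in (0 : ℝ)..t, ∫ x, θ s x * h x) :=
    intervalIntegral.integral_mono_on_of_le_Ioo hT.le hFi (intervalIntegrable_const.add hGi)
      fun t ht => hH1 t ht.1
  have hsplit : ∫ t in (0 : ℝ)..T, (1 / 2 * (∫ y, θ₀ y ^ 2) + ∫ s in (0 : ℝ)..t, ∫ x, θ s x * h x) =
      T * (1 / 2 * ∫ x, θ₀ x ^ 2) + ∫ t in (0 : ℝ)..T, ∫ τ in (0 : ℝ)..t, ∫ x, θ τ x * h x := by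
    rw [intervalIntegral.integral_add intervalIntegrable_const hGi, intervalIntegral.integral_const,
      smul_eq_mul, sub_zero]
  calc T / 2 * ∫ t in (0 : ℝ)..(T / 2), κ * (Torus.eScalarGradNormSq (θ t)).toReal
      ≤ ∫ t in (0 : ℝ)..T, ∫ s in (0 : ℝ)..t, κ * (Torus.eScalarGradNormSq (θ s)).toReal :=
        half_mul_intervalIntegral_le_intervalIntegral_primitive hT hD0 hDi
    _ ≤ _ := hint
    _ = _ := hsplit

end Summit.AnomalousDissipation.AnomalousDissipation.Theorems.TwohalfdNeg.Condensate
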